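import Mathlib.Analysis.Matrix.PosDef
import Mathlib.Analysis.SpecialFunctions.Sqrt
import Mathlib.Analysis.SpecialFunctions.ExpDeriv
import Mathlib.Analysis.Calculus.MeanValue
import Mathlib.LinearAlgebra.Matrix.BilinearForm
import Literature.Geometry.Lorentzian.InverseMeanCurvatureFlow
import Literature.Geometry.Lorentzian.TwoParameterMaps
import Literature.Geometry.Lorentzian.GeodesicSpeed
import Literature.Geometry.Lorentzian.CurveThroughVelocity
import Literature.Geometry.Lorentzian.VolumeChartFormula
import HarnessLib

/-!
# Exponential growth of area under the classical inverse mean curvature flow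
# (discharge of `area_exp_classical`, Huisken–Ilmanen (1.1))

This file discharges the named fact `Literature.Geometry.Lorentzian.area_exp_classical` of
`InverseMeanCurvatureFlow.lean` (`area_exp_classical_holds`): for a classical solution
`IsClassicalIMCF h hpb F ν a b` of the inverse mean curvature flow `∂F/∂t = ν/H`, `H > 0`, by
immersions `F t : S → X` of a compact surface in a Riemannian `3`-manifold `(X, h)`, the areas of
the induced metrics satisfy `|N_t| = e^{t-s} |N_s|` for `s, t ∈ (a, b)` — Huisken–Ilmanen,
J. Differential Geom. 59 (2001), §1, (1.1) and the display following it: "by the first variation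
formula (see (1.11)), the area element evolves in the normal direction by
`∂/∂t dμ_t = H v dμ_t = dμ_t` (`v` the outward normal speed) … therefore `d/dt |N_t| = |N_t|`,
`|N_t| = e^t |N_0|`".

## The printed proof and its formalisation

The printed proof is the first variation of area for the normal variation `∂_t F = H⁻¹ ν`
("proven by differentiating under the integral sign", HI after (1.11)) followed by the ODE
`A' = A`. We prove the *pointwise* statement (1.1) for the area element and integrate it with the
chart formula for the Riemannian measure:

* **The area element in a frame.** For `p ∈ S` and tangent vectors `v₁, v₂ ∈ T_p S` let
  `G(τ)ᵢⱼ = h(dF_τ vᵢ, dF_τ vⱼ)` be the Gram matrix of the induced metric `F_τ^* h`. The heart of the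
  file is `IsClassicalIMCF.hasDerivAt_det_gram`: `(det G)' = 2 det G` on `(a, b)` (i.e.
  `∂_t √det G = H · H⁻¹ · √det G`, which is (1.1)), for a basis on which the second fundamental
  form `K_ν` of `Hypersurface.lean` is computed by the covariant derivative of `ν` along
  chart-straight curves (its defining basis `Module.finBasis`; any basis once
  `secondFundamentalForm_apply` is available). Ingredients, all proved in the tree:
  - the product rule along the curve `τ ↦ F τ p`, `G'ᵢⱼ = h(DVᵢ/dτ, Vⱼ) + h(Vᵢ, DVⱼ/dτ)` for the
    variation fields `Vᵢ(τ) = dF_τ vᵢ` (`PseudoRiemannianMetric.hasDerivAt_val_apply_along`,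
    `GeodesicSpeed.lean`, with the Levi-Civita connection compatible and torsion-free by
    `isLeviCivita_leviCivita_holds`);
  - the symmetry lemma for the two-parameter map `(τ, σ) ↦ F τ (c(σ))`, `c` the chart-straight
    curve through `p` with velocity `vᵢ`: `DVᵢ/dτ = D(∂_τ F ∘ c)/dσ` (O'Neill 1983, Ch. 4,
    Prop. 44 (1); `covariantDerivAlong_velocity_comm` of `TwoParameterMaps.lean`);
  - the flow equation `∂_τ F = H⁻¹ ν`, the Leibniz rule along `c` (`covariantDerivAlong_smul_holds`)
    and `ν ⊥ dF(TS)`, giving `h(DVᵢ/dτ, Vⱼ) = H⁻¹ h(D_{vᵢ} ν, dF vⱼ) = H⁻¹ K(vᵢ, vⱼ)`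
    (`IsClassicalIMCF.val_covariantDerivAlong_velocity`, `hasDerivAt_val_mfderiv`);
  - the metric trace in a basis, `H = tr_{F^*h} K = ∑ᵢⱼ K(vᵢ, vⱼ) (G⁻¹)ⱼᵢ`
    (`PseudoRiemannianMetric.trace_eq_sum_mul_inv_gram`) and Jacobi's formula
    `(det G)' = det G · tr(G⁻¹ G')` (`jacobi_fin_two`), whence `(det G)' = det G · H⁻¹ · 2H`.
* **The ODE.** `(√det G)' = √det G` (`det G > 0`, `det_gram_pos`) gives
  `√det G(t) = e^{t-s} √det G(s)` (`eq_exp_mul_of_hasDerivAt_self`,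
  `IsClassicalIMCF.sqrt_det_gram_eq_exp_mul`), and by a change of basis the same for the Gram
  matrix of *any* pair of tangent vectors (`sqrt_det_gram_eq_exp_mul_sqrt_det_gram`), in
  particular for the coordinate vectors of a chart of `S`.
* **Integration.** `totalArea` is the Euclidean-normalised `2`-dimensional Hausdorff measure of the
  length metric (`Volume.lean`), which the chart formula
  `riemannianMeasure_eq_integral_sqrt_det` (proved in `VolumeChartFormula.lean`) expresses on
  measurable subsets of chart domains as `∫ √det G dy`; a finite chart cover of the compact
  surface and additivity give `|N_t| = e^{t-s} |N_s|`
  (`riemannianMeasure_eq_ofReal_mul_of_chartGram`, `area_exp_classical_of_areaFormula`,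
  `area_exp_classical_holds`).

Nothing here is specific to dimension `2` except the explicit `2 × 2` Jacobi formula and the
positivity/finite-cover bookkeeping; the statement of the fact is for surfaces in `3`-manifolds.

## References

* G. Huisken, T. Ilmanen, *The inverse mean curvature flow and the Riemannian Penrose
  inequality*, J. Differential Geom. 59 (2001) 353–437: §1, (1.1) and the display following it
  (`d/dt |N_t| = |N_t|`, `|N_t| = e^t |N_0|`), (1.11) (first variation formula,
  "proven by differentiating under the integral sign") (key `HuiskenIlmanenIMCF2001`).
* B. O'Neill, *Semi-Riemannian geometry with applications to relativity*, Academic Press 1983,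
  Ch. 3, Prop. 18 (induced covariant derivative, product rule), pp. 60–61 (metric contraction);
  Ch. 4, Prop. 44 (1) (`x_{uv} = x_{vu}`) (key `ONeill1983`).
* H. Federer, *Geometric Measure Theory*, Springer 1969, §3.2.46 (Riemannian measure = Hausdorff
  measure; used through `VolumeChartFormula.lean`).
-/

noncomputable section

open Bundle Set Filter Function Manifold Matrix
open scoped Manifold ContDiff Topology

namespace Literature.Geometry.Lorentzian

/-! ### Linear algebra and one-variable calculus -/

section Algebra

/-- **The Gram matrix of a basis for a positive definite symmetric bilinear form is positive
definite**: `xᵀ (B(eᵢ, eⱼ)) x = B(∑ xᵢ eᵢ, ∑ xⱼ eⱼ) > 0` for `x ≠ 0`. [folklore] -/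
theorem posDef_gram {V : Type*} [AddCommGroup V] [Module ℝ V] {ι : Type*} [Fintype ι]
    [DecidableEq ι] (e : Module.Basis ι ℝ V) (Bf : LinearMap.BilinForm ℝ V)
    (hsymm : ∀ v w, Bf v w = Bf w v) (hpos : ∀ v, v ≠ 0 → 0 < Bf v v) :
    (Matrix.of fun i j ↦ Bf (e i) (e j)).PosDef := by
  refine Matrix.PosDef.of_dotProduct_mulVec_pos ?_ fun x hx ↦ ?_
  · ext i j
    simpa using hsymm (e j) (e i)
  · have h : star x ⬝ᵥ ((Matrix.of fun i j ↦ Bf (e i) (e j)) *ᵥ x) =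
        Bf (∑ i, x i • e i) (∑ j, x j • e j) := by
      simp only [dotProduct, mulVec, Matrix.of_apply, star_trivial, map_sum, map_smul,
        LinearMap.sum_apply, LinearMap.smul_apply, smul_eq_mul, Finset.mul_sum]
      refine Finset.sum_congr rfl fun i _ ↦ Finset.sum_congr rfl fun j _ ↦ ?_
      rw [hsymm (e j) (e i)]
      ring
    rw [h]
    refine hpos _ fun h0 ↦ hx ?_
    funext i
    exact Fintype.linearIndependent_iff.1 e.linearIndependent x h0 i

/-- The Gram determinant of a basis for a positive definite symmetric bilinear form is positive
(`Matrix.PosDef.det_pos`). [folklore] -/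
theorem det_gram_pos {V : Type*} [AddCommGroup V] [Module ℝ V] {ι : Type*} [Fintype ι]
    [DecidableEq ι] (e : Module.Basis ι ℝ V) (Bf : LinearMap.BilinForm ℝ V)
    (hsymm : ∀ v w, Bf v w = Bf w v) (hpos : ∀ v, v ≠ 0 → 0 < Bf v v) :
    0 < (Matrix.of fun i j ↦ Bf (e i) (e j)).det :=
  (posDef_gram e Bf hsymm hpos).det_pos

/-- **Change of basis for Gram matrices**: if `vᵢ = ∑ₖ Pₖᵢ eₖ` (`P` the coordinate matrix of the
family `v` in the basis `e`) then `(B(vᵢ, vⱼ)) = Pᵀ (B(eₖ, eₗ)) P`. [folklore] -/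
theorem gram_eq_transpose_mul_mul {V : Type*} [AddCommGroup V] [Module ℝ V] {ι κ : Type*}
    [Fintype ι] [Fintype κ] (e : Module.Basis ι ℝ V) (Bf : LinearMap.BilinForm ℝ V) (v : κ → V) :
    (Matrix.of fun i j ↦ Bf (v i) (v j)) =
      (Matrix.of fun k i ↦ e.repr (v i) k)ᵀ * (Matrix.of fun k l ↦ Bf (e k) (e l)) *
        (Matrix.of fun k i ↦ e.repr (v i) k) := by
  ext i j
  have hi : v i = ∑ k, e.repr (v i) k • e k := (e.sum_repr (v i)).symm
  have hj : v j = ∑ l, e.repr (v j) l • e l := (e.sum_repr (v j)).symm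
  rw [Matrix.of_apply, hi, hj]
  simp only [map_sum, map_smul, LinearMap.sum_apply, LinearMap.smul_apply, smul_eq_mul,
    Matrix.mul_apply, Matrix.transpose_apply, Matrix.of_apply, Finset.sum_mul, Finset.mul_sum]
  refine Finset.sum_congr rfl fun k _ ↦ Finset.sum_congr rfl fun l _ ↦ ?_
  ring

/-- Derivative of a `2 × 2` determinant: `(G₀₀G₁₁ - G₀₁G₁₀)' = G'₀₀G₁₁ + G₀₀G'₁₁ - G'₀₁G₁₀ - G₀₁G'₁₀`
(product rule). [folklore] -/
theorem hasDerivAt_det_fin_two {G : ℝ → Matrix (Fin 2) (Fin 2) ℝ} {G' : Matrix (Fin 2) (Fin 2) ℝ}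
    {t : ℝ} (h : ∀ i j, HasDerivAt (fun t ↦ G t i j) (G' i j) t) :
    HasDerivAt (fun t ↦ (G t).det)
      (G' 0 0 * G t 1 1 + G t 0 0 * G' 1 1 - (G' 0 1 * G t 1 0 + G t 0 1 * G' 1 0)) t := by
  simp_rw [Matrix.det_fin_two]
  exact ((h 0 0).mul (h 1 1)).sub ((h 0 1).mul (h 1 0))

/-- **Jacobi's formula for `2 × 2` matrices**: for invertible `G`, the derivative of the
determinant in the direction `G'` is `det G · tr(G⁻¹ G') = det G · ∑ᵢⱼ (G⁻¹)ᵢⱼ G'ⱼᵢ` (explicit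
inverse `G⁻¹ = (det G)⁻¹ adj G`). [folklore] -/
theorem jacobi_fin_two (G G' : Matrix (Fin 2) (Fin 2) ℝ) (hG : G.det ≠ 0) :
    G' 0 0 * G 1 1 + G 0 0 * G' 1 1 - (G' 0 1 * G 1 0 + G 0 1 * G' 1 0) =
      G.det * ∑ i, ∑ j, G⁻¹ i j * G' j i := by
  rw [Matrix.inv_def, Matrix.adjugate_fin_two, Ring.inverse_eq_inv']
  simp only [Fin.sum_univ_two, Matrix.smul_apply, smul_eq_mul, Matrix.of_apply, Matrix.cons_val',
    Matrix.cons_val_zero, Matrix.cons_val_one, Matrix.empty_val', Matrix.cons_val_fin_one]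
  rw [Matrix.det_fin_two] at hG ⊢
  have hG' : G 1 1 * G 0 0 - G 1 0 * G 0 1 ≠ 0 := by convert hG using 1; ring
  field_simp
  ring

/-- If `D' = 2D` at `t` and `D(t) > 0` then `(√D)' = √D` at `t` (`(√D)' = D'/(2√D)`). [folklore] -/
theorem hasDerivAt_sqrt_of_hasDerivAt_two_mul {D : ℝ → ℝ} {t : ℝ} (hD : HasDerivAt D (2 * D t) t)
    (hpos : 0 < D t) : HasDerivAt (fun t ↦ Real.sqrt (D t)) (Real.sqrt (D t)) t := by
  have h := hD.sqrt hpos.ne'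
  convert h using 1
  have hs : 0 < Real.sqrt (D t) := Real.sqrt_pos.2 hpos
  rw [eq_div_iff (by positivity), mul_left_comm, Real.mul_self_sqrt hpos.le]

/-- **`f' = f` on an open interval forces `f(t) = e^{t-s} f(s)`**: `e^{-τ} f(τ)` has zero
derivative on `(a, b)`, hence is constant there (Mathlib's `IsOpen.is_const_of_deriv_eq_zero`).
This is the step "`d/dt |N_t| = |N_t|`, `|N_t| = e^t |N_0|`" of Huisken–Ilmanen 2001, §1, after
(1.1). [cite: HuiskenIlmanenIMCF2001, §1 after (1.1)] -/
theorem eq_exp_mul_of_hasDerivAt_self {f : ℝ → ℝ} {a b : ℝ}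
    (hf : ∀ τ ∈ Ioo a b, HasDerivAt f (f τ) τ) {s t : ℝ} (hs : s ∈ Ioo a b) (ht : t ∈ Ioo a b) :
    f t = Real.exp (t - s) * f s := by
  set g : ℝ → ℝ := fun τ ↦ Real.exp (-τ) * f τ with hg
  have hg' : ∀ τ ∈ Ioo a b, HasDerivAt g 0 τ := by
    intro τ hτ
    have h1 : HasDerivAt (fun τ ↦ Real.exp (-τ)) (-Real.exp (-τ)) τ := by
      simpa using ((hasDerivAt_id τ).neg).exp
    exact (h1.mul (hf τ hτ)).congr_deriv (by ring)
  have hconst : g t = g s :=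
    isOpen_Ioo.is_const_of_deriv_eq_zero isPreconnected_Ioo
      (fun τ hτ ↦ (hg' τ hτ).differentiableAt.differentiableWithinAt)
      (fun τ hτ ↦ (hg' τ hτ).deriv) ht hs
  simp only [hg] at hconst
  calc f t = Real.exp t * (Real.exp (-t) * f t) := by
        rw [← mul_assoc, ← Real.exp_add, add_neg_cancel, Real.exp_zero, one_mul]
    _ = Real.exp t * (Real.exp (-s) * f s) := by rw [hconst]
    _ = Real.exp (t - s) * f s := by rw [← mul_assoc, ← Real.exp_add, sub_eq_add_neg]

end Algebra

/-! ### The metric trace in a basis -/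

namespace PseudoRiemannianMetric

section Trace

variable
  {EB : Type*} [NormedAddCommGroup EB] [NormedSpace ℝ EB]
  {HB : Type*} [TopologicalSpace HB] {IB : ModelWithCorners ℝ EB HB} {n : ℕ∞ω}
  {B : Type*} [TopologicalSpace B] [ChartedSpace HB B]
  {F : Type*} [NormedAddCommGroup F] [NormedSpace ℝ F]
  {E : B → Type*} [TopologicalSpace (TotalSpace F E)]
  [∀ b, TopologicalSpace (E b)] [∀ b, AddCommGroup (E b)] [∀ b, Module ℝ (E b)]
  [FiberBundle F E] [VectorBundle ℝ F E]
  (g : PseudoRiemannianMetric IB n F E) (b₀ : B)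

/-- The Gram matrix `(g_b(eᵢ, eⱼ))` of a basis of the fibre is invertible, by nondegeneracy of the
metric (`LinearMap.BilinForm.nondegenerate_iff_det_ne_zero`). [folklore] -/
theorem isUnit_det_gram {ι : Type*} [Fintype ι] [DecidableEq ι] (e : Module.Basis ι ℝ (E b₀)) :
    IsUnit (Matrix.of fun i j ↦ g.val b₀ (e i) (e j)).det := by
  have hnd := g.nondegenerate_toBilinForm b₀
  rw [LinearMap.BilinForm.nondegenerate_iff_det_ne_zero e] at hnd
  have h : LinearMap.BilinForm.toMatrix e (g.toBilinForm b₀) =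
      Matrix.of fun i j ↦ g.val b₀ (e i) (e j) := by
    ext i j
    rw [LinearMap.BilinForm.toMatrix_apply, toBilinForm_apply, Matrix.of_apply]
  rw [h] at hnd
  exact isUnit_iff_ne_zero.2 hnd

variable [FiniteDimensional ℝ F]

/-- **The metric trace in a basis**: for a basis `e` of the fibre with Gram matrix
`Γ = (g_b(eᵢ, eⱼ))`, the metric contraction of a bilinear form is
`tr_g T = ∑ᵢ ∑ₘ T(eᵢ, eₘ) (Γ⁻¹)ₘᵢ = gⁱᵐ Tᵢₘ` (the coordinates of `♯(T(eᵢ, ·))` in the basis are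
`(T(eᵢ, eₘ))ₘ Γ⁻¹`, by `g(♯α, w) = α w`). O'Neill 1983, Ch. 3, pp. 60–61 (metric contraction in a
frame, `C(ξ ⊗ ω ⊗ …) = ∑ gⁱʲ …`). [cite: ONeill1983, Ch. 3, pp. 60–61] -/
theorem trace_eq_sum_mul_inv_gram {ι : Type*} [Fintype ι] [DecidableEq ι]
    (e : Module.Basis ι ℝ (E b₀)) (T : LinearMap.BilinForm ℝ (E b₀)) :
    g.trace b₀ T = ∑ i, ∑ m, T (e i) (e m) * (Matrix.of fun i j ↦ g.val b₀ (e i) (e j))⁻¹ m i := by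
  set Γ : Matrix ι ι ℝ := Matrix.of fun i j ↦ g.val b₀ (e i) (e j) with hΓ_def
  have hΓ : IsUnit Γ.det := g.isUnit_det_gram b₀ e
  change LinearMap.trace ℝ (E b₀) ((g.sharp b₀).toLinearMap ∘ₗ T) = _
  rw [LinearMap.trace_eq_matrix_trace ℝ e, Matrix.trace]
  refine Finset.sum_congr rfl fun i _ ↦ ?_
  rw [Matrix.diag_apply, LinearMap.toMatrix_apply, LinearMap.comp_apply]
  set w : E b₀ := (g.sharp b₀).toLinearMap (T (e i)) with hw_def
  have hr : Matrix.vecMul (e.repr w) Γ = fun m ↦ T (e i) (e m) := by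
    ext m
    have hw : w = ∑ j, e.repr w j • e j := (e.sum_repr w).symm
    calc Matrix.vecMul (e.repr w) Γ m = ∑ j, e.repr w j * g.val b₀ (e j) (e m) := by
          simp [Matrix.vecMul, dotProduct, hΓ_def]
      _ = g.val b₀ (∑ j, e.repr w j • e j) (e m) := by
          rw [map_sum, _root_.sum_apply]
          refine Finset.sum_congr rfl fun j _ ↦ ?_
          rw [map_smul, _root_.smul_apply, smul_eq_mul]
      _ = g.val b₀ w (e m) := by rw [← hw]
      _ = T (e i) (e m) := by rw [hw_def]; exact g.val_sharp_apply b₀ (T (e i)) (e m)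
  have hr' : (e.repr w : ι → ℝ) = Matrix.vecMul (fun m ↦ T (e i) (e m)) Γ⁻¹ := by
    rw [← hr, Matrix.vecMul_vecMul, Matrix.mul_nonsing_inv _ hΓ, Matrix.vecMul_one]
  rw [show e.repr w i = (e.repr w : ι → ℝ) i from rfl, hr']
  simp [Matrix.vecMul, dotProduct]

end Trace

end PseudoRiemannianMetric

/-! ### Base-point bookkeeping for vector fields along curves -/

section Congr

variable {E : Type*} [NormedAddCommGroup E] [NormedSpace ℝ E] {H : Type*} [TopologicalSpace H]
  {I : ModelWithCorners ℝ E H} {M : Type*} [TopologicalSpace M] [ChartedSpace H M]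
  [IsManifold I ∞ M] [FiniteDimensional ℝ E]

omit [FiniteDimensional ℝ E] in
/-- Transport of the differentiability of a lift `t ↦ (γ t, V t) ∈ TM` along an equality of base
curves `γ = γ'` (the fibres of `TM` are all the model space `E`). [folklore] -/
theorem mdifferentiableAt_lift_congr_base {γ γ' : ℝ → M} (hγ : γ = γ') {V : ℝ → E} {t₀ : ℝ}
    (hV : MDifferentiableAt 𝓘(ℝ, ℝ) I.tangent
      (fun t ↦ (TotalSpace.mk' E (γ t) (V t) : TangentBundle I M)) t₀) :
    MDifferentiableAt 𝓘(ℝ, ℝ) I.tangent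
      (fun t ↦ (TotalSpace.mk' E (γ' t) (V t) : TangentBundle I M)) t₀ := by
  subst hγ
  exact hV

/-- Transport of the covariant derivative along a curve `DV/dt` along an equality of base curves
`γ = γ'` (same vector-valued `V`). [folklore] -/
theorem covariantDerivAlong_congr_base
    (cov : CovariantDerivative I E (TangentSpace I : M → Type _)) {γ γ' : ℝ → M} (hγ : γ = γ')
    (V : ℝ → E) (t₀ : ℝ) :
    (covariantDerivAlong cov γ (fun t ↦ (V t : TangentSpace I (γ t))) t₀ : E) =
      covariantDerivAlong cov γ' (fun t ↦ (V t : TangentSpace I (γ' t))) t₀ := by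
  subst hγ
  rfl

end Congr

/-! ### The first variation of the area element under the flow -/

open PseudoRiemannianMetric

section Core

variable {X : Type*} [TopologicalSpace X] [ChartedSpace E3 X] [IsManifold (𝓡 3) ∞ X]
  {h : ContMDiffRiemannianMetric (𝓡 3) ∞ E3 (TangentSpace (𝓡 3) : X → Type _)}
  [(ofRiemannian h).HasLeviCivita]
  {S : Type*} [TopologicalSpace S] [ChartedSpace (EuclideanSpace ℝ (Fin 2)) S]
  [IsManifold (𝓡 2) ∞ S]
  {hpb : contMDiff_pullbackBilin (𝓡 3) X (𝓡 2) S ∞}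
  {F : ℝ → S → X} {ν : (t : ℝ) → NormalField (𝓡 3) (F t)} {a b : ℝ}

namespace IsClassicalIMCF

/-- The flow map `(t, y) ↦ F t y` of a classical solution is `C^∞` at every `(t, y)` with
`t ∈ (a, b)` (the joint smoothness field of `IsClassicalIMCF`, on the open set `(a, b) × S`).
Huisken–Ilmanen 2001, §0 (∗) ("a smooth family"). [cite: HuiskenIlmanenIMCF2001, §0 (∗)] -/
theorem contMDiffAt_uncurry (Hc : IsClassicalIMCF h hpb F ν a b) {t : ℝ}
    (ht : t ∈ Ioo a b) (y : S) :
    ContMDiffAt (𝓘(ℝ, ℝ).prod (𝓡 2)) (𝓡 3) ∞ (fun q : ℝ × S ↦ F q.1 q.2) (t, y) :=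
  Hc.contMDiffOn.contMDiffAt ((isOpen_Ioo.prod isOpen_univ).mem_nhds ⟨ht, mem_univ y⟩)

/-- Each immersion `F t`, `t ∈ (a, b)`, of a classical solution is `C^∞` (restriction of the flow
map to a time slice). [cite: HuiskenIlmanenIMCF2001, §0 (∗)] -/
theorem contMDiffAt_slice (Hc : IsClassicalIMCF h hpb F ν a b) {t : ℝ}
    (ht : t ∈ Ioo a b) (y : S) : ContMDiffAt (𝓡 2) (𝓡 3) ∞ (F t) y := by
  have h1 : ContMDiffAt (𝓡 2) (𝓘(ℝ, ℝ).prod (𝓡 2)) ∞ (fun y' : S ↦ ((t, y') : ℝ × S)) y :=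
    contMDiffAt_const.prodMk contMDiffAt_id
  exact (Hc.contMDiffAt_uncurry ht y).comp y h1

/-- Each immersion `F t`, `t ∈ (a, b)`, of a classical solution is differentiable.
[cite: HuiskenIlmanenIMCF2001, §0 (∗)] -/
theorem mdifferentiableAt_slice (Hc : IsClassicalIMCF h hpb F ν a b) {t : ℝ}
    (ht : t ∈ Ioo a b) (y : S) : MDifferentiableAt (𝓡 2) (𝓡 3) (F t) y :=
  (Hc.contMDiffAt_slice ht y).mdifferentiableAt (by simp)

/-- The two-parameter map `(t, σ) ↦ F t (c σ)` obtained by flowing the chart-straight curve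
`c = curveThrough (𝓡 2) p v` (`Geodesic.lean`) is `C²` at `(t, 0)` for `t ∈ (a, b)` (composition of
the smooth flow map with the smooth curve, `contMDiffAt_curveThrough_zero`); this is the
two-parameter map to which O'Neill's symmetry lemma (Ch. 4, Prop. 44 (1)) is applied. [folklore] -/
theorem contMDiffAt_uncurry_curveThrough (Hc : IsClassicalIMCF h hpb F ν a b)
    {t : ℝ} (ht : t ∈ Ioo a b) (p : S) (v : TangentSpace (𝓡 2) p) :
    ContMDiffAt (𝓘(ℝ, ℝ).prod 𝓘(ℝ, ℝ)) (𝓡 3) 2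
      (uncurry fun t' s ↦ F t' (curveThrough (𝓡 2) p v s)) (t, 0) := by
  have hc : ContMDiffAt 𝓘(ℝ, ℝ) (𝓡 2) ∞ (curveThrough (𝓡 2) p v) 0 :=
    contMDiffAt_curveThrough_zero p v
  have h1 : ContMDiffAt (𝓘(ℝ, ℝ).prod 𝓘(ℝ, ℝ)) (𝓘(ℝ, ℝ).prod (𝓡 2)) ∞
      (fun q : ℝ × ℝ ↦ ((q.1, curveThrough (𝓡 2) p v q.2) : ℝ × S)) (t, 0) :=
    contMDiffAt_fst.prodMk
      (ContMDiffAt.comp (t, 0) (g := curveThrough (𝓡 2) p v) (f := Prod.snd) hc contMDiffAt_snd)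
  have h2 := (Hc.contMDiffAt_uncurry ht (curveThrough (𝓡 2) p v 0)).comp (t, 0) h1
  exact h2.of_le (by decide)

/-- The `σ`-velocity at `σ = 0` of `σ ↦ F t (c σ)`, `c` the chart-straight curve through `p` with
velocity `v`, is `dF_t(v)` (chain rule and `velocity_curveThrough_zero_holds`): the variation
field of the two-parameter map is the differential of the immersion. O'Neill 1983, Ch. 4, p. 122
(`x_v = dx(∂_v)`). [cite: ONeill1983, Ch. 4, p. 122] -/
theorem velocity_comp_curveThrough (Hc : IsClassicalIMCF h hpb F ν a b) {t : ℝ}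
    (ht : t ∈ Ioo a b) (p : S) (v : TangentSpace (𝓡 2) p) :
    (velocity (𝓡 3) (fun s ↦ F t (curveThrough (𝓡 2) p v s)) 0 : E3) =
      mfderiv (𝓡 2) (𝓡 3) (F t) p v := by
  have hc : MDifferentiableAt 𝓘(ℝ, ℝ) (𝓡 2) (curveThrough (𝓡 2) p v) 0 :=
    (contMDiffAt_curveThrough_zero (n := 1) p v).mdifferentiableAt one_ne_zero
  have hv : velocity (𝓡 2) (curveThrough (𝓡 2) p v) 0 = v :=
    velocity_curveThrough_zero_holds BoundarylessManifold.isInteriorPoint v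
  have h1 := mfderiv_comp_apply_of_eq (hg := Hc.mdifferentiableAt_slice ht p) (hf := hc)
    (hy := curveThrough_zero (𝓡 2) p v) (v := (1 : ℝ))
  exact h1.trans (congrArg (mfderiv (𝓡 2) (𝓡 3) (F t) p) hv)

/-- The unit normal restricted to a chart-straight curve, `σ ↦ (F t (c σ), ν t (c σ)) ∈ TX`, is
differentiable at `σ = 0` (the normal is a smooth map into `TX`, field `contMDiff_normal` of
`IsClassicalIMCF`). [folklore] -/
theorem mdifferentiableAt_lift_normal (Hc : IsClassicalIMCF h hpb F ν a b) {t : ℝ}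
    (ht : t ∈ Ioo a b) (p : S) (v : TangentSpace (𝓡 2) p) :
    MDifferentiableAt 𝓘(ℝ, ℝ) (𝓡 3).tangent
      (fun s ↦ (TotalSpace.mk' E3 (F t (curveThrough (𝓡 2) p v s))
        (ν t (curveThrough (𝓡 2) p v s)) : TangentBundle (𝓡 3) X)) 0 :=
  (((Hc.contMDiff_normal t ht).contMDiffAt).comp 0
    (contMDiffAt_curveThrough_zero p v)).mdifferentiableAt (by simp)

/-- **The normal speed is `1/H`**: for a classical solution, `h(∂_t F, ν) = H⁻¹` at every
`(t, y)`, `t ∈ (a, b)` (flow equation `∂_t F = H⁻¹ ν` and `h(ν, ν) = 1`). Huisken–Ilmanen 2001,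
§0 (∗) and §1 ("write `v` for the outward normal speed", `v = 1/H`).
[cite: HuiskenIlmanenIMCF2001, §1 (1.1)] -/
theorem val_velocity_normal (Hc : IsClassicalIMCF h hpb F ν a b) {t : ℝ} (ht : t ∈ Ioo a b)
    (y : S) :
    (ofRiemannian h).val (F t y) (velocity (𝓡 3) (fun s ↦ F s y) t) (ν t y) =
      ((ofRiemannian h).meanCurvature (F t) hpb (Hc.isSpacelikeImmersion t ht) (ν t) y)⁻¹ := by
  have h1 : velocity (𝓡 3) (fun s ↦ F s y) t =
      ((ofRiemannian h).meanCurvature (F t) hpb (Hc.isSpacelikeImmersion t ht) (ν t) y)⁻¹ •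
        ν t y := Hc.velocity_eq t ht y
  rw [h1, map_smul, _root_.smul_apply, (Hc.isUnitNormal t ht).val_self y, smul_eq_mul, mul_one]

/-- **The covariant derivative of the variation field, paired with a tangent vector.** For a
classical solution, `t₀ ∈ (a, b)`, `p ∈ S` and `v, w ∈ T_p S`, let `V(t) = ∂_σ|₀ F t (c σ)` be the
variation field along `t ↦ F t p` of the two-parameter map through the chart-straight curve `c`
with `c(0) = p`, `c'(0) = v`. Then `h(DV/dt(t₀), dF_{t₀} w) = H(t₀, p)⁻¹ · h(D_v ν, dF_{t₀} w)`, where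
`D_v ν = normalDerivAlong` is the covariant derivative of the unit normal along `c`
(`Hypersurface.lean`). Proof: `DV/dt = D(∂_t F ∘ c)/dσ` (symmetry lemma, O'Neill 1983, Ch. 4,
Prop. 44 (1), `covariantDerivAlong_velocity_comm`), `∂_t F = H⁻¹ ν` along `c` (flow equation), the
Leibniz rule `D(H⁻¹ν)/dσ = (H⁻¹)' ν + H⁻¹ Dν/dσ` (`covariantDerivAlong_smul_holds`; `H⁻¹ = h(∂_t F, ν)`
is differentiable along `c` by the product rule), and `h(ν, dF w) = 0`. This is the computation
`∂_t g_{ij} = 2 H⁻¹ A_{ij}` behind Huisken–Ilmanen's (1.1) (and (1.2)).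
[cite: HuiskenIlmanenIMCF2001, §1 (1.1)] -/
theorem val_covariantDerivAlong_velocity (Hc : IsClassicalIMCF h hpb F ν a b) {t₀ : ℝ}
    (ht₀ : t₀ ∈ Ioo a b) (p : S) (v w : TangentSpace (𝓡 2) p) :
    (ofRiemannian h).val (F t₀ p)
        (covariantDerivAlong (ofRiemannian h).leviCivita (fun t ↦ F t p)
          (fun t ↦ (velocity (𝓡 3) (fun s ↦ F t (curveThrough (𝓡 2) p v s)) 0 :
            TangentSpace (𝓡 3) (F t p))) t₀)
        (mfderiv (𝓡 2) (𝓡 3) (F t₀) p w) =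
      ((ofRiemannian h).meanCurvature (F t₀) hpb (Hc.isSpacelikeImmersion t₀ ht₀) (ν t₀) p)⁻¹ *
        (ofRiemannian h).val (F t₀ p)
          ((ofRiemannian h).normalDerivAlong (F t₀) (ν t₀) p v)
          (mfderiv (𝓡 2) (𝓡 3) (F t₀) p w) := by
  set g := ofRiemannian h with hg
  set cov := g.leviCivita with hcov
  set c : ℝ → S := curveThrough (𝓡 2) p v with hc_def
  set f : ℝ → ℝ → X := fun t s ↦ F t (c s) with hf_def
  set Hm : S → ℝ := fun y ↦ g.meanCurvature (F t₀) hpb (Hc.isSpacelikeImmersion t₀ ht₀) (ν t₀) y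
    with hHm
  set φ : ℝ → ℝ := fun s ↦ (Hm (c s))⁻¹ with hφ_def
  have hLC := isLeviCivita_leviCivita_holds (g := g)
  have hc0 : c 0 = p := curveThrough_zero (𝓡 2) p v
  have hx : ContMDiffAt (𝓘(ℝ, ℝ).prod 𝓘(ℝ, ℝ)) (𝓡 3) 2 (uncurry f) (t₀, 0) :=
    Hc.contMDiffAt_uncurry_curveThrough ht₀ p v
  -- symmetry lemma, with the base curve `t ↦ F t (c 0)` transported to `t ↦ F t p`
  have hbase : (fun t ↦ f t 0) = fun t ↦ F t p := by
    funext t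
    simp [hf_def, hc0]
  have hsymm : (covariantDerivAlong cov (fun t ↦ F t p)
      (fun t ↦ (velocity (𝓡 3) (fun s ↦ F t (c s)) 0 : TangentSpace (𝓡 3) (F t p))) t₀ : E3) =
        covariantDerivAlong cov (fun s ↦ F t₀ (c s))
          (fun s ↦ velocity (𝓡 3) (fun t ↦ F t (c s)) t₀) 0 := by
    rw [← covariantDerivAlong_congr_base cov hbase
      (fun t ↦ (velocity (𝓡 3) (fun s ↦ F t (c s)) 0 : E3)) t₀]
    exact covariantDerivAlong_velocity_comm cov hLC.1 hx
  -- the `t`-velocity field along the `s`-curve is `φ • ν`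
  have hW : (fun s ↦ velocity (𝓡 3) (fun t ↦ F t (c s)) t₀) = fun s ↦ φ s • ν t₀ (c s) := by
    funext s
    exact Hc.velocity_eq t₀ ht₀ (c s)
  -- differentiability of `φ` via `φ = h(∂_t F, ν)` along the curve
  have hνlift := Hc.mdifferentiableAt_lift_normal ht₀ p v
  have hVlift : MDifferentiableAt 𝓘(ℝ, ℝ) (𝓡 3).tangent
      (fun s ↦ (TotalSpace.mk' E3 (F t₀ (c s)) (velocity (𝓡 3) (fun t ↦ F t (c s)) t₀) :
        TangentBundle (𝓡 3) X)) 0 :=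
    mdifferentiableAt_lift_velocity_curry_left hx
  have hφeq : φ = fun s ↦ g.val (F t₀ (c s)) (velocity (𝓡 3) (fun t ↦ F t (c s)) t₀)
      (ν t₀ (c s)) := by
    funext s
    exact (Hc.val_velocity_normal ht₀ (c s)).symm
  have hφ : DifferentiableAt ℝ φ 0 := by
    rw [hφeq]
    exact (g.hasDerivAt_val_apply_along hLC.2 hVlift hνlift).differentiableAt
  -- Leibniz rule
  have hLeib := covariantDerivAlong_smul_holds cov (γ := fun s ↦ F t₀ (c s))
    (W := fun s ↦ ν t₀ (c s)) (f := φ) (t₀ := 0) hφ hνlift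
  rw [hsymm, hW, hLeib]
  -- move everything into the fibre at `F t₀ p`
  change g.val (F t₀ p) (deriv φ 0 • (show TangentSpace (𝓡 3) (F t₀ p) from ν t₀ (c 0)) +
    φ 0 • (show TangentSpace (𝓡 3) (F t₀ p) from
      covariantDerivAlong cov (fun s ↦ F t₀ (c s)) (fun s ↦ ν t₀ (c s)) 0))
    (mfderiv (𝓡 2) (𝓡 3) (F t₀) p w) = _
  rw [map_add, _root_.add_apply, map_smul, map_smul, _root_.smul_apply, _root_.smul_apply,
    smul_eq_mul, smul_eq_mul]
  -- `ν ⊥ dF w` and `φ 0 = H⁻¹`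
  have hνp : ∀ z : S, z = p → (show TangentSpace (𝓡 3) (F t₀ p) from ν t₀ z) = ν t₀ p := by
    rintro z rfl
    rfl
  have hν0 : g.val (F t₀ p) (show TangentSpace (𝓡 3) (F t₀ p) from ν t₀ (c 0))
      (mfderiv (𝓡 2) (𝓡 3) (F t₀) p w) = 0 := by
    rw [hνp _ hc0]
    exact (Hc.isUnitNormal t₀ ht₀).isNormalTo p w
  have hφ0 : φ 0 = (Hm p)⁻¹ := by
    show (Hm (c 0))⁻¹ = (Hm p)⁻¹
    rw [hc0]
  rw [hν0, mul_zero, zero_add, hφ0]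
  rfl

/-- **Evolution of the induced metric**: for a classical solution, `t₀ ∈ (a, b)`, `p ∈ S` and
`v, w ∈ T_p S`, the function `τ ↦ (F_τ^* h)_p(v, w) = h(dF_τ v, dF_τ w)` has derivative
`H⁻¹ (h(D_v ν, dF w) + h(D_w ν, dF v))` at `t₀` — the classical `∂_t g_{ij} = 2 H⁻¹ A_{ij}` for the
flow (∗) (product rule along `τ ↦ F τ p`, `hasDerivAt_val_apply_along`, applied to the variation
fields of the two-parameter maps through the chart-straight curves with velocities `v`, `w`, and
`val_covariantDerivAlong_velocity`). Huisken–Ilmanen 2001, §1, (1.1)–(1.2) (evolution of the area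
element and of the geometry under (∗)). [cite: HuiskenIlmanenIMCF2001, §1 (1.1)] -/
theorem hasDerivAt_val_mfderiv (Hc : IsClassicalIMCF h hpb F ν a b) {t₀ : ℝ}
    (ht₀ : t₀ ∈ Ioo a b) (p : S) (v w : TangentSpace (𝓡 2) p) :
    HasDerivAt (fun τ ↦ (ofRiemannian h).val (F τ p) (mfderiv (𝓡 2) (𝓡 3) (F τ) p v)
        (mfderiv (𝓡 2) (𝓡 3) (F τ) p w))
      (((ofRiemannian h).meanCurvature (F t₀) hpb (Hc.isSpacelikeImmersion t₀ ht₀) (ν t₀) p)⁻¹ *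
        ((ofRiemannian h).val (F t₀ p) ((ofRiemannian h).normalDerivAlong (F t₀) (ν t₀) p v)
            (mfderiv (𝓡 2) (𝓡 3) (F t₀) p w) +
          (ofRiemannian h).val (F t₀ p) ((ofRiemannian h).normalDerivAlong (F t₀) (ν t₀) p w)
            (mfderiv (𝓡 2) (𝓡 3) (F t₀) p v))) t₀ := by
  set g := ofRiemannian h with hg
  set cov := g.leviCivita with hcov
  have hLC := isLeviCivita_leviCivita_holds (g := g)
  -- the two variation fields, as `E3`-valued functions of `τ`
  set Vv : ℝ → E3 := fun τ ↦ velocity (𝓡 3) (fun s ↦ F τ (curveThrough (𝓡 2) p v s)) 0 with hVv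
  set Vw : ℝ → E3 := fun τ ↦ velocity (𝓡 3) (fun s ↦ F τ (curveThrough (𝓡 2) p w s)) 0 with hVw
  have hbase : ∀ u : TangentSpace (𝓡 2) p,
      (fun t ↦ (fun t s ↦ F t (curveThrough (𝓡 2) p u s)) t 0) = fun t ↦ F t p := by
    intro u
    funext t
    simp [curveThrough_zero]
  have hlift : ∀ u : TangentSpace (𝓡 2) p, MDifferentiableAt 𝓘(ℝ, ℝ) (𝓡 3).tangent
      (fun τ ↦ (TotalSpace.mk' E3 (F τ p)
        (velocity (𝓡 3) (fun s ↦ F τ (curveThrough (𝓡 2) p u s)) 0 : E3) :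
          TangentBundle (𝓡 3) X)) t₀ := fun u ↦
    mdifferentiableAt_lift_congr_base (hbase u)
      (mdifferentiableAt_lift_velocity_curry_right (Hc.contMDiffAt_uncurry_curveThrough ht₀ p u))
  have hP := g.hasDerivAt_val_apply_along hLC.2 (γ := fun τ ↦ F τ p)
    (V := fun τ ↦ (Vv τ : TangentSpace (𝓡 3) (F τ p)))
    (W := fun τ ↦ (Vw τ : TangentSpace (𝓡 3) (F τ p))) (hlift v) (hlift w)
  -- near `t₀` the variation fields are the differentials
  have hev : ∀ᶠ τ in 𝓝 t₀, τ ∈ Ioo a b := isOpen_Ioo.mem_nhds ht₀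
  have heq : (fun τ ↦ g.val (F τ p) (Vv τ) (Vw τ)) =ᶠ[𝓝 t₀] fun τ ↦
      g.val (F τ p) (mfderiv (𝓡 2) (𝓡 3) (F τ) p v) (mfderiv (𝓡 2) (𝓡 3) (F τ) p w) := by
    filter_upwards [hev] with τ hτ
    simp only [hVv, hVw]
    rw [Hc.velocity_comp_curveThrough hτ p v, Hc.velocity_comp_curveThrough hτ p w]
  refine (hP.congr_of_eventuallyEq heq.symm).congr_deriv ?_
  have hv₀ : Vv t₀ = mfderiv (𝓡 2) (𝓡 3) (F t₀) p v := Hc.velocity_comp_curveThrough ht₀ p v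
  have hw₀ : Vw t₀ = mfderiv (𝓡 2) (𝓡 3) (F t₀) p w := Hc.velocity_comp_curveThrough ht₀ p w
  rw [hw₀, hv₀, g.symm (F t₀ p) (mfderiv (𝓡 2) (𝓡 3) (F t₀) p v)]
  simp only [hVv, hVw]
  rw [Hc.val_covariantDerivAlong_velocity ht₀ p v w, Hc.val_covariantDerivAlong_velocity ht₀ p w v,
    mul_add]

/-- **The area element evolves by `∂_t dμ_t = dμ_t`** (Huisken–Ilmanen 2001, (1.1):
`∂/∂t dμ_t = H v dμ_t = dμ_t`), in the form: for a basis `β` of `T_p S` on which the second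
fundamental form `K_ν` is computed by the covariant derivative of `ν` along chart-straight curves
(`hK`; true for the defining basis, `secondFundamentalForm_apply_basis`), the Gram determinant
`D(τ) = det (h(dF_τ βᵢ, dF_τ βⱼ))` satisfies `D' = 2D` at `t₀ ∈ (a, b)` (so `(√D)' = √D`). Proof:
entrywise `G' = H⁻¹ (A + Aᵀ)` with `Aᵢⱼ = K(βᵢ, βⱼ)` (`hasDerivAt_val_mfderiv`), Jacobi's formula
`(det G)' = det G · ∑ (G⁻¹)ᵢⱼ G'ⱼᵢ` (`jacobi_fin_two`, `det G > 0`), symmetry of `G⁻¹`, and the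
trace formula `H = tr_{F^*h} K = ∑ Aᵢₘ (G⁻¹)ₘᵢ` (`trace_eq_sum_mul_inv_gram`), giving
`(det G)' = det G · H⁻¹ · 2H`. [cite: HuiskenIlmanenIMCF2001, §1 (1.1)] -/
theorem hasDerivAt_det_gram (Hc : IsClassicalIMCF h hpb F ν a b) {t₀ : ℝ} (ht₀ : t₀ ∈ Ioo a b)
    (p : S) (β : Module.Basis (Fin 2) ℝ (TangentSpace (𝓡 2) p))
    (hK : ∀ (i : Fin 2) (w : TangentSpace (𝓡 2) p),
      (ofRiemannian h).secondFundamentalForm (𝓡 2) (F t₀) (ν t₀) p (β i) w =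
        (ofRiemannian h).val (F t₀ p) ((ofRiemannian h).normalDerivAlong (F t₀) (ν t₀) p (β i))
          (mfderiv (𝓡 2) (𝓡 3) (F t₀) p w)) :
    HasDerivAt (fun τ ↦ (Matrix.of fun i j ↦ (ofRiemannian h).val (F τ p)
        (mfderiv (𝓡 2) (𝓡 3) (F τ) p (β i)) (mfderiv (𝓡 2) (𝓡 3) (F τ) p (β j))).det)
      (2 * (Matrix.of fun i j ↦ (ofRiemannian h).val (F t₀ p)
        (mfderiv (𝓡 2) (𝓡 3) (F t₀) p (β i)) (mfderiv (𝓡 2) (𝓡 3) (F t₀) p (β j))).det) t₀ := by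
  classical
  set g := ofRiemannian h with hg
  set hf := Hc.isSpacelikeImmersion t₀ ht₀ with hhf
  set G : ℝ → Matrix (Fin 2) (Fin 2) ℝ := fun τ ↦ Matrix.of fun i j ↦ g.val (F τ p)
    (mfderiv (𝓡 2) (𝓡 3) (F τ) p (β i)) (mfderiv (𝓡 2) (𝓡 3) (F τ) p (β j)) with hG_def
  set A : Matrix (Fin 2) (Fin 2) ℝ := Matrix.of fun i j ↦ g.val (F t₀ p)
    (g.normalDerivAlong (F t₀) (ν t₀) p (β i)) (mfderiv (𝓡 2) (𝓡 3) (F t₀) p (β j)) with hA_def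
  set Hp : ℝ := g.meanCurvature (F t₀) hpb hf (ν t₀) p with hHp_def
  have hHp : Hp ≠ 0 := (Hc.meanCurvature_pos t₀ ht₀ p).ne'
  -- entrywise derivatives (Stage B)
  have hG' : ∀ i j, HasDerivAt (fun τ ↦ G τ i j) (Hp⁻¹ * (A i j + A j i)) t₀ := fun i j ↦ by
    simpa only [hG_def, hA_def, Matrix.of_apply] using Hc.hasDerivAt_val_mfderiv ht₀ p (β i) (β j)
  have hdet := hasDerivAt_det_fin_two hG'
  -- `det G(t₀) > 0`
  have hpos : 0 < (G t₀).det := by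
    have := det_gram_pos β ((g.inducedMetric (F t₀) hpb hf).toBilinForm p)
      (fun v w ↦ (g.inducedMetric (F t₀) hpb hf).symm p v w)
      (fun v hv ↦ hf.inducedBilin_pos p hv)
    simpa only [toBilinForm_apply, inducedMetric_val, inducedBilin_apply] using this
  have hJ := jacobi_fin_two (G t₀) (Matrix.of fun i j ↦ Hp⁻¹ * (A i j + A j i)) hpos.ne'
  simp only [Matrix.of_apply] at hJ
  -- the trace formula for `H`
  have htr : Hp = ∑ i, ∑ m, A i m * (G t₀)⁻¹ m i := by
    have hΓ : (Matrix.of fun i j ↦ (g.inducedMetric (F t₀) hpb hf).val p (β i) (β j)) = G t₀ := by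
      ext i j
      simp only [hG_def, Matrix.of_apply, inducedMetric_val, inducedBilin_apply]
    have h1 := (g.inducedMetric (F t₀) hpb hf).trace_eq_sum_mul_inv_gram p β
      (g.secondFundamentalForm (𝓡 2) (F t₀) (ν t₀) p)
    rw [hΓ] at h1
    refine h1.trans (Finset.sum_congr rfl fun i _ ↦ Finset.sum_congr rfl fun m _ ↦ ?_)
    rw [hK i (β m)]
    rfl
  -- `G⁻¹` is symmetric
  have hGs : (G t₀)ᵀ = G t₀ := by
    ext i j
    simp only [hG_def, Matrix.transpose_apply, Matrix.of_apply]
    exact g.symm (F t₀ p) _ _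
  have hGis : ∀ i j, (G t₀)⁻¹ j i = (G t₀)⁻¹ i j := fun i j ↦ by
    rw [← Matrix.transpose_apply (G t₀)⁻¹ i j, Matrix.transpose_nonsing_inv, hGs]
  -- the two contractions both equal `H`
  have hs1 : ∑ i, ∑ j, (G t₀)⁻¹ i j * A j i = Hp := by
    rw [htr, Finset.sum_comm]
    refine Finset.sum_congr rfl fun i _ ↦ Finset.sum_congr rfl fun j _ ↦ ?_
    ring
  have hs2 : ∑ i, ∑ j, (G t₀)⁻¹ i j * A i j = Hp := by
    rw [htr]
    refine Finset.sum_congr rfl fun i _ ↦ Finset.sum_congr rfl fun j _ ↦ ?_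
    rw [hGis j i]
    ring
  have hsum : ∑ i, ∑ j, (G t₀)⁻¹ i j * (Hp⁻¹ * (A j i + A i j)) = 2 := by
    have : ∑ i, ∑ j, (G t₀)⁻¹ i j * (Hp⁻¹ * (A j i + A i j)) =
        Hp⁻¹ * (∑ i, ∑ j, (G t₀)⁻¹ i j * A j i + ∑ i, ∑ j, (G t₀)⁻¹ i j * A i j) := by
      rw [← Finset.sum_add_distrib, Finset.mul_sum]
      refine Finset.sum_congr rfl fun i _ ↦ ?_
      rw [← Finset.sum_add_distrib, Finset.mul_sum]
      refine Finset.sum_congr rfl fun j _ ↦ ?_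
      ring
    rw [this, hs1, hs2]
    field_simp
    ring
  refine hdet.congr_deriv ?_
  rw [hJ, hsum]
  ring

/-- **`dμ_t = e^{t-s} dμ_s` pointwise**: for a basis `β` of `T_p S` as in `hasDerivAt_det_gram`
(at all times), `√det (h(dF_t βᵢ, dF_t βⱼ)) = e^{t-s} √det (h(dF_s βᵢ, dF_s βⱼ))` for
`s, t ∈ (a, b)`: `(√D)' = √D` on `(a, b)` and the ODE lemma `eq_exp_mul_of_hasDerivAt_self`.
Huisken–Ilmanen 2001, §1, (1.1) and the display after it. [cite: HuiskenIlmanenIMCF2001, §1 (1.1)] -/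
theorem sqrt_det_gram_eq_exp_mul (Hc : IsClassicalIMCF h hpb F ν a b) (p : S)
    (β : Module.Basis (Fin 2) ℝ (TangentSpace (𝓡 2) p))
    (hK : ∀ (τ : ℝ) (hτ : τ ∈ Ioo a b) (i : Fin 2) (w : TangentSpace (𝓡 2) p),
      (ofRiemannian h).secondFundamentalForm (𝓡 2) (F τ) (ν τ) p (β i) w =
        (ofRiemannian h).val (F τ p) ((ofRiemannian h).normalDerivAlong (F τ) (ν τ) p (β i))
          (mfderiv (𝓡 2) (𝓡 3) (F τ) p w))
    {s t : ℝ} (hs : s ∈ Ioo a b) (ht : t ∈ Ioo a b) :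
    Real.sqrt (Matrix.of fun i j ↦ (ofRiemannian h).val (F t p)
        (mfderiv (𝓡 2) (𝓡 3) (F t) p (β i)) (mfderiv (𝓡 2) (𝓡 3) (F t) p (β j))).det =
      Real.exp (t - s) * Real.sqrt (Matrix.of fun i j ↦ (ofRiemannian h).val (F s p)
        (mfderiv (𝓡 2) (𝓡 3) (F s) p (β i)) (mfderiv (𝓡 2) (𝓡 3) (F s) p (β j))).det := by
  classical
  set g := ofRiemannian h with hg
  set D : ℝ → ℝ := fun τ ↦ (Matrix.of fun i j ↦ g.val (F τ p)
    (mfderiv (𝓡 2) (𝓡 3) (F τ) p (β i)) (mfderiv (𝓡 2) (𝓡 3) (F τ) p (β j))).det with hD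
  have hpos : ∀ τ ∈ Ioo a b, 0 < D τ := fun τ hτ ↦ by
    have := det_gram_pos β
      ((g.inducedMetric (F τ) hpb (Hc.isSpacelikeImmersion τ hτ)).toBilinForm p)
      (fun v w ↦ (g.inducedMetric (F τ) hpb (Hc.isSpacelikeImmersion τ hτ)).symm p v w)
      (fun v hv ↦ (Hc.isSpacelikeImmersion τ hτ).inducedBilin_pos p hv)
    simpa only [toBilinForm_apply, inducedMetric_val, inducedBilin_apply] using this
  have hderiv : ∀ τ ∈ Ioo a b, HasDerivAt (fun τ ↦ Real.sqrt (D τ)) (Real.sqrt (D τ)) τ :=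
    fun τ hτ ↦ hasDerivAt_sqrt_of_hasDerivAt_two_mul
      (Hc.hasDerivAt_det_gram hτ p β (hK τ hτ)) (hpos τ hτ)
  exact eq_exp_mul_of_hasDerivAt_self hderiv hs ht


/-- **Exponential growth of the area element** (Huisken–Ilmanen 2001, (1.1), integrated in
time): for a classical solution, `p ∈ S`, any two tangent vectors `v₀, v₁ ∈ T_p S` and
`s, t ∈ (a, b)`, `√det ((F_t^*h)_p(vᵢ, vⱼ)) = e^{t-s} √det ((F_s^*h)_p(vᵢ, vⱼ))`. Reduction to the
defining basis `β` of the second fundamental form (`Module.finBasis`, reindexed by `Fin 2`;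
`secondFundamentalForm_apply_basis`) by the change of basis `(g(vᵢ, vⱼ)) = Pᵀ (g(βₖ, βₗ)) P`
(`gram_eq_transpose_mul_mul`), `√(det P² · D) = |det P| √D`, and `sqrt_det_gram_eq_exp_mul`.
[cite: HuiskenIlmanenIMCF2001, §1 (1.1)] -/
theorem sqrt_det_gram_eq_exp_mul_sqrt_det_gram (Hc : IsClassicalIMCF h hpb F ν a b) (p : S)
    (v : Fin 2 → TangentSpace (𝓡 2) p) {s t : ℝ} (hs : s ∈ Ioo a b) (ht : t ∈ Ioo a b) :
    Real.sqrt (Matrix.of fun i j ↦ (ofRiemannian h).val (F t p)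
        (mfderiv (𝓡 2) (𝓡 3) (F t) p (v i)) (mfderiv (𝓡 2) (𝓡 3) (F t) p (v j))).det =
      Real.exp (t - s) * Real.sqrt (Matrix.of fun i j ↦ (ofRiemannian h).val (F s p)
        (mfderiv (𝓡 2) (𝓡 3) (F s) p (v i)) (mfderiv (𝓡 2) (𝓡 3) (F s) p (v j))).det := by
  classical
  set g := ofRiemannian h with hg
  haveI : FiniteDimensional ℝ (TangentSpace (𝓡 2) p) :=
    inferInstanceAs (FiniteDimensional ℝ (EuclideanSpace ℝ (Fin 2)))
  set β : Module.Basis (Fin 2) ℝ (TangentSpace (𝓡 2) p) :=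
    (Module.finBasis ℝ (TangentSpace (𝓡 2) p)).reindex
      (finCongr (finrank_euclideanSpace_fin : Module.finrank ℝ (TangentSpace (𝓡 2) p) = 2))
    with hβ
  have hK : ∀ (τ : ℝ) (hτ : τ ∈ Ioo a b) (i : Fin 2) (w : TangentSpace (𝓡 2) p),
      g.secondFundamentalForm (𝓡 2) (F τ) (ν τ) p (β i) w =
        g.val (F τ p) (g.normalDerivAlong (F τ) (ν τ) p (β i)) (mfderiv (𝓡 2) (𝓡 3) (F τ) p w) := by
    intro τ hτ i w
    rw [hβ, Module.Basis.reindex_apply]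
    exact g.secondFundamentalForm_apply_basis (F τ) (ν τ) p _ w
  -- change of basis `v i = ∑ₖ P k i • β k`
  set P : Matrix (Fin 2) (Fin 2) ℝ := Matrix.of fun k i ↦ β.repr (v i) k with hP
  have hGram : ∀ τ, (Matrix.of fun i j ↦ g.val (F τ p) (mfderiv (𝓡 2) (𝓡 3) (F τ) p (v i))
      (mfderiv (𝓡 2) (𝓡 3) (F τ) p (v j))) =
        Pᵀ * (Matrix.of fun k l ↦ g.val (F τ p) (mfderiv (𝓡 2) (𝓡 3) (F τ) p (β k))
          (mfderiv (𝓡 2) (𝓡 3) (F τ) p (β l))) * P := fun τ ↦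
    gram_eq_transpose_mul_mul β ((g.inducedBilin (𝓡 2) (F τ) p).toLinearMap₁₂) v
  have hdet : ∀ τ, (Matrix.of fun i j ↦ g.val (F τ p) (mfderiv (𝓡 2) (𝓡 3) (F τ) p (v i))
      (mfderiv (𝓡 2) (𝓡 3) (F τ) p (v j))).det =
        P.det ^ 2 * (Matrix.of fun k l ↦ g.val (F τ p) (mfderiv (𝓡 2) (𝓡 3) (F τ) p (β k))
          (mfderiv (𝓡 2) (𝓡 3) (F τ) p (β l))).det := fun τ ↦ by
    rw [hGram τ, Matrix.det_mul, Matrix.det_mul, Matrix.det_transpose]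
    ring
  have hsqrt : ∀ τ, Real.sqrt ((Matrix.of fun i j ↦ g.val (F τ p)
      (mfderiv (𝓡 2) (𝓡 3) (F τ) p (v i)) (mfderiv (𝓡 2) (𝓡 3) (F τ) p (v j))).det) =
        |P.det| * Real.sqrt ((Matrix.of fun k l ↦ g.val (F τ p)
          (mfderiv (𝓡 2) (𝓡 3) (F τ) p (β k)) (mfderiv (𝓡 2) (𝓡 3) (F τ) p (β l))).det) :=
    fun τ ↦ by
    rw [hdet τ, Real.sqrt_mul (sq_nonneg _), Real.sqrt_sq_eq_abs]
  rw [hsqrt t, hsqrt s, Hc.sqrt_det_gram_eq_exp_mul p β hK hs ht]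
  ring

end IsClassicalIMCF

end Core

/-! ### Measure-theoretic assembly -/

section Measure

open MeasureTheory

variable {H : Type*} [TopologicalSpace H] {m : ℕ} {I : ModelWithCorners ℝ (EuclideanSpace ℝ (Fin m)) H}
  {n : ℕ∞ω} {N : Type*} [TopologicalSpace N] [ChartedSpace H N] [IsManifold I 1 N] [T3Space N]
  [MeasurableSpace N] [BorelSpace N]

/-- **Scaling of the Riemannian measure from scaling of the chart densities.** On a compact
manifold modelled on `ℝ^m`, if two `C^n` Riemannian metrics `h₁, h₂` have chart densities related
by `√det (h₁)_{ij}(y) = c √det (h₂)_{ij}(y)` at every point `y` of every extended chart target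
(`c ≥ 0` a constant) and the chart formula for the Riemannian measure holds (the named fact
`riemannianMeasure_eq_integral_sqrt_det` of `Volume.lean`, hypothesis `hA`; proved in
`VolumeChartFormula.lean`), then `vol_{h₁}(s) = c · vol_{h₂}(s)` for every measurable `s`: on
measurable subsets of a chart domain this is the chart formula and linearity of the integral; in
general, split `s` along a finite chart cover and use additivity. This is the passage from
`∂_t dμ_t = dμ_t` to `d/dt |N_t| = |N_t|` in Huisken–Ilmanen 2001, §1, (1.1). [folklore] -/
theorem riemannianMeasure_eq_ofReal_mul_of_chartGram [CompactSpace N]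
    (hA : riemannianMeasure_eq_integral_sqrt_det (I := I) (n := n) (N := N))
    (h₁ h₂ : ContMDiffRiemannianMetric I n (EuclideanSpace ℝ (Fin m)) (TangentSpace I : N → Type _))
    {c : ℝ} (hc : 0 ≤ c)
    (hpt : ∀ (x : N) (y : EuclideanSpace ℝ (Fin m)), y ∈ (extChartAt I x).target →
      Real.sqrt (chartGramMatrix h₁ x y).det = c * Real.sqrt (chartGramMatrix h₂ x y).det)
    {s : Set N} (hs : MeasurableSet s) :
    riemannianMeasure h₁ s = ENNReal.ofReal c * riemannianMeasure h₂ s := by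
  classical
  -- on measurable subsets of a chart domain: the chart formula
  have hchart : ∀ (x : N) (A : Set N), MeasurableSet A → A ⊆ (extChartAt I x).source →
      riemannianMeasure h₁ A = ENNReal.ofReal c * riemannianMeasure h₂ A := by
    intro x A hAm hAx
    rw [hA h₁ x hAm hAx, hA h₂ x hAm hAx]
    have hsub : extChartAt I x '' A ⊆ (extChartAt I x).target := by
      rintro y ⟨z, hz, rfl⟩
      exact (extChartAt I x).map_source (hAx hz)
    have heq : (fun y ↦ ENNReal.ofReal (Real.sqrt (chartGramMatrix h₁ x y).det))
        =ᵐ[volume.restrict (extChartAt I x '' A)]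
          fun y ↦ ENNReal.ofReal c * ENNReal.ofReal (Real.sqrt (chartGramMatrix h₂ x y).det) := by
      have h1 : (fun y ↦ ENNReal.ofReal (Real.sqrt (chartGramMatrix h₁ x y).det))
          =ᵐ[volume.restrict (extChartAt I x).target]
            fun y ↦ ENNReal.ofReal c * ENNReal.ofReal (Real.sqrt (chartGramMatrix h₂ x y).det) := by
        filter_upwards [ae_restrict_mem (measurableSet_extChartAt_target x)] with y hy
        rw [hpt x y hy, ENNReal.ofReal_mul hc]
      exact ae_mono (Measure.restrict_mono_set volume hsub) h1
    rw [lintegral_congr_ae heq, lintegral_const_mul' _ _ ENNReal.ofReal_ne_top]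
  -- a finite chart cover, and induction on it
  obtain ⟨T, hT⟩ := isCompact_univ.elim_finite_subcover (fun x : N ↦ (extChartAt I x).source)
    (fun x ↦ isOpen_extChartAt_source x) (fun x _ ↦ mem_iUnion.2 ⟨x, mem_extChartAt_source x⟩)
  suffices key : ∀ (T : Finset N) (A : Set N), MeasurableSet A →
      A ⊆ (⋃ x ∈ T, (extChartAt I x).source) →
        riemannianMeasure h₁ A = ENNReal.ofReal c * riemannianMeasure h₂ A from
    key T s hs fun z hz ↦ hT (mem_univ z)
  intro T
  induction T using Finset.induction_on with
  | empty =>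
    intro A _ hAT
    have hA0 : A = ∅ := subset_empty_iff.1 (by simpa using hAT)
    subst hA0
    simp
  | insert x T hxT ih =>
    intro A hAm hAT
    have hsrc : MeasurableSet (extChartAt I x).source := (isOpen_extChartAt_source x).measurableSet
    have hsplit : A = (A ∩ (extChartAt I x).source) ∪ (A \ (extChartAt I x).source) :=
      (inter_union_sdiff _ _).symm
    have hdisj : Disjoint (A ∩ (extChartAt I x).source) (A \ (extChartAt I x).source) :=
      disjoint_left.2 fun z hz hz' ↦ hz'.2 hz.2
    have hrest : A \ (extChartAt I x).source ⊆ ⋃ y ∈ T, (extChartAt I y).source := by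
      intro z hz
      have hz' := hAT hz.1
      rw [Finset.set_biUnion_insert, mem_union] at hz'
      exact hz'.resolve_left hz.2
    rw [hsplit, measure_union hdisj (hAm.diff hsrc), measure_union hdisj (hAm.diff hsrc), mul_add,
      hchart x _ (hAm.inter hsrc) inter_subset_right, ih _ (hAm.diff hsrc) hrest]

end Measure

/-! ### Exponential growth of area (HI (1.1)) from the area formula -/

section Final

variable {X : Type*} [TopologicalSpace X] [ChartedSpace E3 X] [IsManifold (𝓡 3) ∞ X]
  {S : Type*} [TopologicalSpace S] [ChartedSpace (EuclideanSpace ℝ (Fin 2)) S]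
  [IsManifold (𝓡 2) ∞ S]

/-- The chart Gram matrix (`chartGramMatrix`, `Volume.lean`) of the induced metric `f^* g` at a
chart point `y` is the Gram matrix `(g(df ∂ᵢ, df ∂ⱼ))` of the images of the coordinate vectors
`∂ᵢ = d(φ⁻¹)_y eᵢ` under `df` (unfolding; `inducedRiemannianMetric_inner`, `pullbackBilin_apply`).
[folklore] -/
theorem chartGramMatrix_inducedRiemannianMetric [T3Space S]
    (g : PseudoRiemannianMetric (𝓡 3) ∞ E3 (TangentSpace (𝓡 3) : X → Type _)) (f : S → X)
    (hpb : contMDiff_pullbackBilin (𝓡 3) X (𝓡 2) S ∞) (hf : g.IsSpacelikeImmersion (𝓡 2) f)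
    (x : S) (y : EuclideanSpace ℝ (Fin 2)) :
    chartGramMatrix (g.inducedRiemannianMetric f hpb hf) x y =
      Matrix.of fun i j ↦ g.val (f ((extChartAt (𝓡 2) x).symm y))
        (mfderiv (𝓡 2) (𝓡 3) f ((extChartAt (𝓡 2) x).symm y)
          (mfderivWithin 𝓘(ℝ, EuclideanSpace ℝ (Fin 2)) (𝓡 2) (extChartAt (𝓡 2) x).symm
            (range (𝓡 2)) y (EuclideanSpace.single i 1)))
        (mfderiv (𝓡 2) (𝓡 3) f ((extChartAt (𝓡 2) x).symm y)
          (mfderivWithin 𝓘(ℝ, EuclideanSpace ℝ (Fin 2)) (𝓡 2) (extChartAt (𝓡 2) x).symm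
            (range (𝓡 2)) y (EuclideanSpace.single j 1))) :=
  rfl

/-- **Exponential growth of area under the classical flow, from the chart formula for the
Riemannian measure**: the named fact `area_exp_classical` (`|N_t| = e^{t-s} |N_s|` for classical
solutions of (∗) by immersions of a compact surface; Huisken–Ilmanen 2001, §1, (1.1)) follows
from the chart formula `riemannianMeasure_eq_integral_sqrt_det` for surfaces: `totalArea` is the
Riemannian measure of `univ` (`riemannianVolume _ 2 = riemannianMeasure` as `dim = 2`), the chart
Gram matrices of `F_t^* h` and `F_s^* h` have densities in the ratio `e^{t-s}` at every chart point
(`sqrt_det_gram_eq_exp_mul_sqrt_det_gram` for the coordinate vectors), and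
`riemannianMeasure_eq_ofReal_mul_of_chartGram`. [cite: HuiskenIlmanenIMCF2001, §1 (1.1)] -/
theorem area_exp_classical_of_areaFormula
    (hA : ∀ (N : Type) [TopologicalSpace N] [ChartedSpace (EuclideanSpace ℝ (Fin 2)) N]
      [IsManifold (𝓡 2) 1 N] [T3Space N] [MeasurableSpace N] [BorelSpace N],
      riemannianMeasure_eq_integral_sqrt_det (I := 𝓡 2) (n := (∞ : ℕ∞ω)) (N := N)) :
    area_exp_classical := by
  intro X _ _ _ _ _ h _ S _ _ _ _ _ _ _ hpb F ν a b Hc s t hs ht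
  have hμ : ∀ h' : ContMDiffRiemannianMetric (𝓡 2) ∞ (EuclideanSpace ℝ (Fin 2))
      (TangentSpace (𝓡 2) : S → Type _), totalArea h' = riemannianMeasure h' univ := by
    intro h'
    simp only [totalArea, area_eq, riemannianMeasure, finrank_euclideanSpace_fin]
  rw [hμ, hμ]
  refine riemannianMeasure_eq_ofReal_mul_of_chartGram (hA S) _ _ (Real.exp_pos _).le ?_
    MeasurableSet.univ
  intro x y _
  rw [chartGramMatrix_inducedRiemannianMetric, chartGramMatrix_inducedRiemannianMetric]
  exact Hc.sqrt_det_gram_eq_exp_mul_sqrt_det_gram ((extChartAt (𝓡 2) x).symm y)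
    (fun i ↦ mfderivWithin 𝓘(ℝ, EuclideanSpace ℝ (Fin 2)) (𝓡 2) (extChartAt (𝓡 2) x).symm
      (range (𝓡 2)) y (EuclideanSpace.single i 1)) hs ht

/-- **Exponential growth of area under the classical inverse mean curvature flow** (discharge of
the named fact `area_exp_classical` of `InverseMeanCurvatureFlow.lean`): for a classical solution
`(F t)_{t ∈ (a,b)}` of `∂F/∂t = ν/H`, `H > 0`, by immersions of a compact surface `S` in a Riemannian
`3`-manifold, `|N_t| = e^{t-s} |N_s|` for all `s, t ∈ (a, b)`, the areas being the total areas of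
the induced metrics. Huisken–Ilmanen, J. Differential Geom. 59 (2001), §1, (1.1) and the display
following it (`∂/∂t dμ_t = H v dμ_t = dμ_t`, hence `d/dt |N_t| = |N_t|`, `|N_t| = e^t |N_0|`):
`area_exp_classical_of_areaFormula` and the chart formula for the Riemannian measure
(`riemannianMeasure_eq_integral_sqrt_det_holds`, `VolumeChartFormula.lean`).
[cite: HuiskenIlmanenIMCF2001, §1 (1.1)] -/
theorem area_exp_classical_holds : area_exp_classical :=
  area_exp_classical_of_areaFormula fun _ _ _ _ _ _ _ ↦ riemannianMeasure_eq_integral_sqrt_det_holds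

end Final

end Literature.Geometry.Lorentzian

end
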